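/-
Copyright: derived here (Resolution Observatory cell `pub-rosobs`, carver gen 57). AI-written Lean; AI review is weaker than expert
review.  The induction base of engine 1's THEOREM B′ (THEOREM-LT-eng1-g38 §9: "`|N| ≤ 1` carries no non-trivial graded isotropy at all:
`(ε + A)^d = ε^d` forces `A = 0`; write `d = p^a m`, `p ∤ m`") for the cell's POLYNOMIAL weighted-centre model `W(f)`.
Instrument — NOT a resolution theorem and NOT a statement about the invariant of [AbramovichTemkinWlodarczyk2024].
-/
import Mathlib.Algebra.CharP.Lemmas
import Mathlib.Algebra.Polynomial.Eval.Coeff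
import Mathlib.Algebra.Polynomial.RingDivision
import Mathlib.Algebra.Ring.GeomSum
import Mathlib.Data.Nat.Factorization.Basic
import Mathlib.RingTheory.Polynomial.Basic
import HarnessLib

/-!
# One slot carries no non-trivial isotropy: `(ε + A)^d = ε^d` with `A ∈ (σ)` forces `A = 0` in characteristic `p`

Uniform value line: INSTRUMENT — kernel-checked characteristic-`p` algebra for engine 1's THEOREM B′ induction base (THEOREM-LT-eng1-g38 §9)
in the cell's polynomial weighted-centre model `W(f)`; NOT a resolution theorem, NOT a statement about the Abramovich–Temkin–Włodarczyk
invariant, NOT summit progress; AI-written Lean, AI review is weaker than expert review.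

Setting: `R` a domain of characteristic `p` (cell: `R = k[ε]`, one slot), `R[σ] = R[X]`, `e ∈ R` non-zero (the slot `ε`), `A ∈ R[σ]` with zero constant
term (a substitution `≡ id (mod σ)` moves `ε ↦ ε + A`).  If `g = c ε^d` (`d ≥ 1`) is fixed, `(ε + A)^d = ε^d`, then `A = 0`
(**`eq_zero_of_C_add_pow_eq`**).  Proof (the engine's parenthesis, made explicit): `d = p^a m` with `p ∤ m`; Frobenius gives
`(ε + A)^{p^a} = ε^{p^a} + A^{p^a}`; with `u = ε^{p^a}`, `B = A^{p^a}`: `(u + B)^m − u^m = B · Q` where `Q = Σ_{i<m} (u+B)^i u^{m−1−i}` has constant term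
`m u^{m−1} ≠ 0` (`p ∤ m`, `R` a domain), so `B = 0`, so `A = 0`.  The hypothesis "zero constant term" is necessary: in `𝔽_p`, `(e + a)^{p−1} = e^{p−1} = 1`
for all units.

References: [Lang2002] Ch. IV §1 (polynomial identities), the Frobenius identity `(x + y)^{p^n} = x^{p^n} + y^{p^n}` (Mathlib `add_pow_char_pow`); context
[AbramovichTemkinWlodarczyk2024] §5.  Statements ours, elementary.
-/

namespace Literature.AlgebraicGeometry.Resolution.WeightedBlowup

namespace OneSlot

open Polynomial Finset

variable {R : Type*} [CommRing R]

/-- Constant term of the geometric-sum cofactor: if `B(0) = 0` then `Σ_{i<m} (C u + B)^i (C u)^{m−1−i}` has constant term `m · u^{m−1}`.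
[cite: Lang2002, Ch. IV §1] -/
theorem coeff_zero_geom_sum₂ (u : R) {B : R[X]} (hB : B.coeff 0 = 0) (m : ℕ) :
    (∑ i ∈ range m, (C u + B) ^ i * C u ^ (m - 1 - i)).coeff 0 = m * u ^ (m - 1) := by
  rw [coeff_zero_eq_eval_zero, eval_finsetSum]
  have hB' : eval 0 B = 0 := by rwa [← coeff_zero_eq_eval_zero]
  have : ∀ i ∈ range m, eval 0 ((C u + B) ^ i * C u ^ (m - 1 - i)) = u ^ (m - 1) := fun i hi => by
    rw [eval_mul, eval_pow, eval_pow, eval_add, eval_C, hB', add_zero, ← pow_add,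
      Nat.add_sub_cancel' (Nat.le_sub_one_of_lt (mem_range.mp hi))]
  rw [sum_congr rfl this, sum_const, card_range, nsmul_eq_mul]

/-- The `m`-th power step: `R` a domain, `(m : R) ≠ 0`, `u ≠ 0`, `B(0) = 0` and `(C u + B)^m = C u^m` force `B = 0`.
[cite: Lang2002, Ch. IV §1] -/
theorem eq_zero_of_C_add_pow_eq_of_cast_ne_zero [IsDomain R] {m : ℕ} (hm : (m : R) ≠ 0) {u : R} (hu : u ≠ 0) {B : R[X]}
    (hB : B.coeff 0 = 0) (h : (C u + B) ^ m = C u ^ m) : B = 0 := by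
  have hgeom := geom_sum₂_mul (C u + B) (C u) m
  rw [h, sub_self, add_sub_cancel_left] at hgeom
  rcases mul_eq_zero.mp hgeom with hQ | hB0
  · exfalso
    have h0 := congrArg (fun P : R[X] => P.coeff 0) hQ
    simp only [coeff_zero_geom_sum₂ u hB m, coeff_zero] at h0
    exact mul_ne_zero hm (pow_ne_zero _ hu) h0
  · exact hB0

/-- **One slot carries no non-trivial isotropy** (THEOREM B′, induction base): `R` a domain of characteristic `p`, `e ≠ 0`, `A ∈ R[σ]` with zero constant
term, `d ≥ 1`; then `(C e + A)^d = C e^d` forces `A = 0`. [cite: Lang2002, Ch. IV §1] -/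
theorem eq_zero_of_C_add_pow_eq (p : ℕ) [Fact p.Prime] [CharP R p] [IsDomain R] {e : R} (he : e ≠ 0) {A : R[X]} (hA : A.coeff 0 = 0)
    {d : ℕ} (hd : 0 < d) (h : (C e + A) ^ d = C e ^ d) : A = 0 := by
  obtain ⟨a, m, hpm, rfl⟩ := Nat.exists_eq_pow_mul_and_not_dvd hd.ne' p (Fact.out : p.Prime).ne_one
  have hfrob : (C e + A) ^ p ^ a = C (e ^ p ^ a) + A ^ p ^ a := by rw [add_pow_char_pow, ← C_pow]
  rw [pow_mul, hfrob, pow_mul, ← C_pow] at h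
  have hm : (m : R) ≠ 0 := fun h0 => hpm ((CharP.cast_eq_zero_iff R p m).mp h0)
  have hB : (A ^ p ^ a).coeff 0 = 0 := by
    rw [coeff_zero_eq_eval_zero, eval_pow, ← coeff_zero_eq_eval_zero, hA, zero_pow (pow_ne_zero _ (Fact.out : p.Prime).ne_zero)]
  have hApow : A ^ p ^ a = 0 := eq_zero_of_C_add_pow_eq_of_cast_ne_zero hm (pow_ne_zero _ he) hB (by rw [h, C_pow])
  exact pow_eq_zero_iff (pow_ne_zero _ (Fact.out : p.Prime).ne_zero) |>.mp hApow

/-- The same read as "the substitution is the identity on the slot": `ε ↦ ε + A` with `A ∈ (σ)` fixing `c ε^d` (`c ≠ 0`, `d ≥ 1`) is `ε ↦ ε`.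
[cite: Lang2002, Ch. IV §1] -/
theorem eq_zero_of_smul_C_add_pow_eq (p : ℕ) [Fact p.Prime] [CharP R p] [IsDomain R] {e : R} (he : e ≠ 0) {c : R} (hc : c ≠ 0)
    {A : R[X]} (hA : A.coeff 0 = 0) {d : ℕ} (hd : 0 < d) (h : C c * (C e + A) ^ d = C c * C e ^ d) : A = 0 :=
  eq_zero_of_C_add_pow_eq p he hA hd (mul_left_cancel₀ (C_ne_zero.mpr hc) h)

/-- Necessity of the hypothesis `A ∈ (σ)`: over `𝔽_p` (`p` odd) the non-zero constant `A = C (−2e)` satisfies `(C e + A)^{2} = C e^{2}`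
— recorded as the general identity `(e − 2e)^2 = e^2`. [cite: Lang2002, Ch. IV §1] -/
theorem sq_eq_of_neg_two (e : R) : (C e + C (-2 * e)) ^ 2 = C e ^ 2 := by
  rw [← C_add, ← C_pow, ← C_pow]
  congr 1
  ring

end OneSlot

end Literature.AlgebraicGeometry.Resolution.WeightedBlowup
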